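import Mathlib
import Summits.QuantumAdvantage.QuantumAdvantage.Theses.SelmerBand
import HarnessLib

/-!
# Route `SelmerBand`: the support `BandGlue` (stmt-QuantumAdvantage-17073)

Route `SelmerBand` (quantum-advantage family; crux `PriorBand` = the Bhargava–Shankar /
Bhargava–Shankar–Swaminathan density band `[1/3, 14/15]` for the proportion of elliptic curves
`E_{A,B} : y² = x³ + Ax + B` of naive height `< X` with `#Sel₂(E_{A,B}) ≤ 2`).  This file proves the
support `BandGlue` — pure bookkeeping on the tree's `heightProportion` (Literature
`EllipticCurves/HeightFamily.lean`): lower densities `≥ 1/3` for `P = [#Sel₂ ≤ 2]` and `≥ 1/15` for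
`¬P` give, eventually in `X`, `1/3 − 1/100 ≤ π_X(P) ≤ 14/15 + 1/100`, because the two proportions sum
to `1` as soon as the family below `X` is nonempty (`X ≥ 5`: the curve `y² = x³ + x` has naive height
`4`).

* `one_zero_mem_heightFamilyBelow`, `card_heightFamilyBelow_pos` — the family below `X ≥ 5` is
  nonempty;
* `heightProportion_add_heightProportion_not` — `π_X(P) + π_X(¬P) = 1`;
* `bandGlue_proof` — the item, by name.

HONEST FRAMING: a closed support item of a sibling route (finite-sum bookkeeping), NOT summit
progress; the route's hypothesis-type crux `BeyondConstant` is untouched.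
-/

set_option linter.dupNamespace false -- D-0017: single-problem summit ⇒ `QuantumAdvantage.QuantumAdvantage` by design

namespace Summit.QuantumAdvantage.QuantumAdvantage.Theorems.SelmerBand

open Literature.NumberTheory.EllipticCurves Filter

/-! ### Elementary facts about the height family -/

/-- `(A, B) = (1, 0)` (`y² = x³ + x`, naive height `4`) is in the family below every `X ≥ 5`. [folklore] -/
theorem one_zero_mem_heightFamilyBelow {X : ℕ} (hX : 5 ≤ X) :
    ((1 : ℤ), (0 : ℤ)) ∈ heightFamilyBelow X := by
  rw [mem_heightFamilyBelow_iff]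
  refine ⟨⟨by norm_num, ?_⟩, ?_⟩
  · rintro p hp ⟨h4, _⟩
    have h1 : (p : ℤ) ^ 4 ∣ 1 := h4
    have hle := Int.le_of_dvd one_pos h1
    have hp2 : (2 : ℤ) ≤ p := by exact_mod_cast hp.two_le
    have hpow : (2 : ℤ) ^ 4 ≤ (p : ℤ) ^ 4 := pow_le_pow_left₀ (by norm_num) hp2 4
    norm_num at hpow
    omega
  · have h5 : (5 : ℤ) ≤ (X : ℤ) := by exact_mod_cast hX
    show max (4 * |(1 : ℤ)| ^ 3) (27 * (0 : ℤ) ^ 2) < (X : ℤ)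
    norm_num
    omega

/-- The family below `X ≥ 5` is nonempty. [folklore] -/
theorem card_heightFamilyBelow_pos {X : ℕ} (hX : 5 ≤ X) : 0 < (heightFamilyBelow X).card :=
  Finset.card_pos.mpr ⟨_, one_zero_mem_heightFamilyBelow hX⟩

/-- Complementary proportions add up to `1` (nonempty family). [folklore] -/
theorem heightProportion_add_heightProportion_not (P : ℤ × ℤ → Prop) {X : ℕ}
    (hX : 0 < (heightFamilyBelow X).card) :
    heightProportion P X + heightProportion (fun AB => ¬ P AB) X = 1 := by
  classical
  unfold heightProportion heightAverage
  have hc : ((heightFamilyBelow X).card : ℝ) ≠ 0 := by exact_mod_cast hX.ne'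
  rw [← add_div, ← Finset.sum_add_distrib, div_eq_one_iff_eq hc]
  rw [show ((heightFamilyBelow X).card : ℝ) = ∑ _AB ∈ heightFamilyBelow X, (1 : ℝ) by simp]
  refine Finset.sum_congr rfl fun AB _ => ?_
  by_cases h : P AB <;> simp [h]

/-! ### `BandGlue` (stmt-QuantumAdvantage-17073) -/

/-- **`SelmerBand.BandGlue`**: lower densities `≥ 1/3` for `{#Sel₂ ≤ 2}` and `≥ 1/15` for its
complement give, eventually, the band `[1/3 − 1/100, 14/15 + 1/100]` for the proportion with
`#Sel₂ ≤ 2` (the two proportions sum to `1` on the nonempty family below `X ≥ 5`). [folklore] -/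
theorem bandGlue_proof : Summit.QuantumAdvantage.QuantumAdvantage.Theses.SelmerBand.BandGlue := by
  intro hlow hup
  have h1 := hlow (1 / 100) (by norm_num)
  have h2 := hup (1 / 100) (by norm_num)
  filter_upwards [h1, h2, eventually_ge_atTop 5] with X hX1 hX2 hX5
  have hsum := heightProportion_add_heightProportion_not
    (fun AB : ℤ × ℤ => Nat.card ((shortWeierstrass AB).selmerGroup 2) ≤ 2) (card_heightFamilyBelow_pos hX5)
  constructor
  · exact hX1
  · linarith


end Summit.QuantumAdvantage.QuantumAdvantage.Theorems.SelmerBand
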